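import Literature.NumberTheory.Automorphic.IsomorphismTheoremUniqueProofs
import HarnessLib

/-!
# The isomorphism of maximal tori induced by an identification of character lattices
(trunk T-AUTOMORPHIC, G25 AutomorphicL; step 0 of the graph proof of `chevalley_isomorphism_abstract`)

Towards the named fact `Literature.NumberTheory.Automorphic.chevalley_isomorphism_abstract`
(`ReductiveDualProofs.lean`: step 1 of Springer's proof of the isomorphism theorem, *Linear
Algebraic Groups*, 2nd ed., 9.6.2 — an isomorphism of *abstract* groups `G ≃* G'` inducing the
identity of the common root datum). The route taken on this DAG is the classical *graph method*
(Chevalley, Séminaire 1956–58, exp. 24; Humphreys, *Linear Algebraic Groups*, §32.1 and §33;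
Steinberg, *Lectures on Chevalley groups*, §10): inside `G × G' ≤ GL_{N + N'}` one forms the
closed connected subgroup `H` generated by the graph `T̃` of the isomorphism of tori
`f_T : T → T'` dictated by the root datum and by the "diagonal" root homomorphisms
`x ↦ (u_α(x), u'_α(x))` of the simple roots, and shows — through its Lie algebra in
characteristic `0` — that `H` is the graph of an isomorphism `G → G'`.

This file supplies **the isomorphism of tori** (Springer 9.6.2, proof, via 3.2.10 (3):
`T = Hom(X, k*)`; Humphreys 32.1: "*`φ_T : T → T'` the isomorphism of tori whose comorphism is
the given `X(T') → X(T)`*"). For tori `T ≤ GL n k`, `T' ≤ GL n' k` over an algebraically closed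
field and an isomorphism `e : X*(T') ≃ X*(T)` of character groups:

* `torusIsoOfCharEquiv hT hT' e : ↥T ≃* ↥T'`, characterised by
  `χ' (torusIsoOfCharEquiv t) = (e χ') t` (`apply_torusIsoOfCharEquiv`): existence of the image
  point by `T' = Hom(X*(T'), 𝔾ₘ)` (`IsTorusSubgroup.exists_forall_char_apply_eq`), uniqueness and
  multiplicativity because the characters separate the points of `T'`
  (`eq_of_forall_char_apply_eq`, Springer 3.2.3);
* it is a morphism of algebraic groups in both directions (`isAlgebraicGL_torusIsoOfCharEquiv`,
  `isAlgebraicGL_torusIsoOfCharEquiv_symm`; Springer 3.2.3 (b):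
  `IsTorusSubgroup.isAlgebraicGL_of_isAlgebraicChar_comp`), pulling algebraic characters back to
  algebraic characters (`comp_torusIsoOfCharEquiv_eq`);
* for two pairs `(G, T)`, `(G', T')` with the *same* root datum `P` through `eX, eY`, resp.
  `eX', eY'` (`IsRootDatumOf`), the isomorphism `torusIsoOfWeights eX eX' hT hT'` attached to
  `e = eX'⁻¹ ∘ eX`, i.e. `f_T` with `χ'_x ∘ f_T = χ_x` for every weight `x`
  (`charOfWeight_torusIsoOfWeights`), also matches the cocharacters:
  `f_T ∘ λ_y = λ'_y` (`torusIsoOfWeights_cocharOfCoweight`, from `χ_x(λ_y(s)) = s^{⟨x, y⟩}` on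
  both sides, `IsRootDatumOf.charOfWeight_cocharOfCoweight`) and the membership form
  `mem_iff`/`charOfWeight_eq` used by `InducesRootDatumId` (`ReductiveDualProofs.lean`).

Everything is proved; no named fact is introduced.

## Mathlib

`MulEquiv`, `Additive`/`Multiplicative` transport (`Additive.toMul`, `AddEquiv.trans`).
Mathlib has no algebraic tori; nothing here duplicates a Mathlib or Literature declaration
(searched `torusIso`, `exists_forall_char_apply_eq`, `OfCharEquiv`).

## References

* [SpringerLAG1998] T. A. Springer, *Linear Algebraic Groups*, 2nd ed., Progress in Mathematics
  9, Birkhäuser (1998): 3.2.3, 3.2.10 (3), 3.2.11 (i), Theorem 9.6.2 and its proof.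
* J. E. Humphreys, *Linear Algebraic Groups*, GTM 21, Springer (1975), §32.1, §33.
-/

noncomputable section

open scoped MatrixGroups IsMulCommutative

namespace Literature.NumberTheory.Automorphic

variable {k : Type*} [Field k] {n n' : Type*} [Fintype n] [DecidableEq n] [Fintype n']
  [DecidableEq n']
variable {T : Subgroup (GL n k)} {T' : Subgroup (GL n' k)}

/-! ### Evaluating transported characters -/

section Eval

/-- For an identification `e : X*(T') ≃ X*(T)` of character groups and a point `t ∈ T`, the
homomorphism `X*(T') → kˣ`, `χ' ↦ (e χ')(t)` — the point of `Hom(X*(T'), 𝔾ₘ) = T'` that `t` is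
sent to (Springer 3.2.10 (3)). [folklore] -/
def charEvalHom (e : Additive ↥(characterLattice T') ≃+ Additive ↥(characterLattice T))
    (t : ↥T) : ↥(characterLattice T') →* kˣ where
  toFun χ' := ((Additive.toMul (e (Additive.ofMul χ')) : ↥(characterLattice T)) : ↥T →* kˣ) t
  map_one' := by simp
  map_mul' χ ψ := by simp [ofMul_mul, toMul_add]

/-- The value of `charEvalHom`. [folklore] -/
@[simp] lemma charEvalHom_apply (e : Additive ↥(characterLattice T') ≃+ Additive ↥(characterLattice T))
    (t : ↥T) (χ' : ↥(characterLattice T')) :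
    charEvalHom e t χ' =
      ((Additive.toMul (e (Additive.ofMul χ')) : ↥(characterLattice T)) : ↥T →* kˣ) t :=
  rfl

end Eval

/-! ### The isomorphism of tori attached to an isomorphism of character groups -/

section Iso

variable [IsAlgClosed k] [IsMulCommutative ↥T] [IsMulCommutative ↥T']

/-- The point of `T'` attached to `t ∈ T` by `e : X*(T') ≃ X*(T)`: the unique `t'` with
`χ'(t') = (e χ')(t)` for all `χ' ∈ X*(T')` (existence: `T' = Hom(X*(T'), 𝔾ₘ)`,
`IsTorusSubgroup.exists_forall_char_apply_eq`). Auxiliary to `torusIsoOfCharEquiv`. [folklore] -/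
def torusIsoFun (hT' : IsTorusSubgroup T')
    (e : Additive ↥(characterLattice T') ≃+ Additive ↥(characterLattice T)) (t : ↥T) : ↥T' :=
  (hT'.exists_forall_char_apply_eq (charEvalHom e t)).choose

omit [IsMulCommutative ↥T] [IsMulCommutative ↥T'] in
/-- Defining property of `torusIsoFun`. [folklore] -/
lemma apply_torusIsoFun (hT' : IsTorusSubgroup T')
    (e : Additive ↥(characterLattice T') ≃+ Additive ↥(characterLattice T)) (t : ↥T)
    (χ' : ↥(characterLattice T')) :
    (χ' : ↥T' →* kˣ) (torusIsoFun hT' e t) =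
      ((Additive.toMul (e (Additive.ofMul χ')) : ↥(characterLattice T)) : ↥T →* kˣ) t :=
  (hT'.exists_forall_char_apply_eq (charEvalHom e t)).choose_spec χ'

omit [IsMulCommutative ↥T'] in
/-- `torusIsoFun` for `e⁻¹` inverts `torusIsoFun` for `e` (characters separate points,
`eq_of_forall_char_apply_eq`). [folklore] -/
lemma torusIsoFun_symm_apply (hT : IsTorusSubgroup T) (hT' : IsTorusSubgroup T')
    (e : Additive ↥(characterLattice T') ≃+ Additive ↥(characterLattice T)) (t : ↥T) :
    torusIsoFun hT e.symm (torusIsoFun hT' e t) = t := by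
  refine eq_of_forall_char_apply_eq hT.2.2 fun χ => ?_
  rw [apply_torusIsoFun hT e.symm, apply_torusIsoFun hT' e]
  simp

omit [IsMulCommutative ↥T] in
/-- `torusIsoFun` is multiplicative (characters separate points). [folklore] -/
lemma torusIsoFun_mul (hT' : IsTorusSubgroup T')
    (e : Additive ↥(characterLattice T') ≃+ Additive ↥(characterLattice T)) (s t : ↥T) :
    torusIsoFun hT' e (s * t) = torusIsoFun hT' e s * torusIsoFun hT' e t := by
  refine eq_of_forall_char_apply_eq hT'.2.2 fun χ' => ?_
  rw [map_mul, apply_torusIsoFun, apply_torusIsoFun, apply_torusIsoFun, map_mul]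

/-- **The isomorphism of tori `T ≃ T'` attached to an isomorphism `e : X*(T') ≃ X*(T)` of
character groups** (Springer 3.2.10 (3): `T = Hom(X*(T), 𝔾ₘ)`; the map `φ_T` of Humphreys 32.1),
characterised by `χ' (torusIsoOfCharEquiv t) = (e χ') t` (`apply_torusIsoOfCharEquiv`).
[cite: SpringerLAG1998, 3.2.10 (3) and 9.6.2 (proof)] -/
def torusIsoOfCharEquiv (hT : IsTorusSubgroup T) (hT' : IsTorusSubgroup T')
    (e : Additive ↥(characterLattice T') ≃+ Additive ↥(characterLattice T)) : ↥T ≃* ↥T' where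
  toFun := torusIsoFun hT' e
  invFun := torusIsoFun hT e.symm
  left_inv := torusIsoFun_symm_apply hT hT' e
  right_inv t' := by
    have h := torusIsoFun_symm_apply hT' hT e.symm t'
    rwa [AddEquiv.symm_symm] at h
  map_mul' := torusIsoFun_mul hT' e

variable (hT : IsTorusSubgroup T) (hT' : IsTorusSubgroup T')
  (e : Additive ↥(characterLattice T') ≃+ Additive ↥(characterLattice T))

/-- **Defining property**: `χ' (f_T t) = (e χ')(t)` for every algebraic character `χ'` of `T'`.
[cite: SpringerLAG1998, 3.2.10 (3)] -/
theorem apply_torusIsoOfCharEquiv (t : ↥T) (χ' : ↥(characterLattice T')) :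
    (χ' : ↥T' →* kˣ) (torusIsoOfCharEquiv hT hT' e t) =
      ((Additive.toMul (e (Additive.ofMul χ')) : ↥(characterLattice T)) : ↥T →* kˣ) t :=
  apply_torusIsoFun hT' e t χ'

/-- The inverse of `torusIsoOfCharEquiv hT hT' e` is `torusIsoOfCharEquiv hT' hT e⁻¹`. [folklore] -/
theorem torusIsoOfCharEquiv_symm :
    (torusIsoOfCharEquiv hT hT' e).symm = torusIsoOfCharEquiv hT' hT e.symm := by
  ext t'
  rfl

/-- `χ (f_T⁻¹ t') = (e⁻¹ χ)(t')` for every algebraic character `χ` of `T`. [folklore] -/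
theorem apply_torusIsoOfCharEquiv_symm (t' : ↥T') (χ : ↥(characterLattice T)) :
    (χ : ↥T →* kˣ) ((torusIsoOfCharEquiv hT hT' e).symm t') =
      ((Additive.toMul (e.symm (Additive.ofMul χ)) : ↥(characterLattice T')) : ↥T' →* kˣ) t' :=
  apply_torusIsoFun hT e.symm t' χ

/-- **`f_T` pulls algebraic characters back to algebraic characters**: `χ' ∘ f_T = e χ'` as
homomorphisms `T → kˣ`. [cite: SpringerLAG1998, 9.6.1] -/
theorem comp_torusIsoOfCharEquiv_eq (χ' : ↥(characterLattice T')) :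
    (χ' : ↥T' →* kˣ).comp (torusIsoOfCharEquiv hT hT' e).toMonoidHom =
      ((Additive.toMul (e (Additive.ofMul χ')) : ↥(characterLattice T)) : ↥T →* kˣ) := by
  ext t
  exact congrArg (fun u : kˣ => (u : k)) (apply_torusIsoOfCharEquiv hT hT' e t χ')

/-- `χ' ∘ f_T` is an algebraic character of `T` for every algebraic character `χ'` of `T'`.
[cite: SpringerLAG1998, 9.6.1] -/
theorem isAlgebraicChar_comp_torusIsoOfCharEquiv {χ' : ↥T' →* kˣ} (hχ' : IsAlgebraicChar χ') :
    IsAlgebraicChar (χ'.comp (torusIsoOfCharEquiv hT hT' e).toMonoidHom) := by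
  have h := comp_torusIsoOfCharEquiv_eq hT hT' e ⟨χ', hχ'⟩
  rw [Subtype.coe_mk] at h
  rw [h]
  exact (Additive.toMul (e (Additive.ofMul ⟨χ', hχ'⟩))).2

/-- `χ ∘ f_T⁻¹` is an algebraic character of `T'` for every algebraic character `χ` of `T`.
[cite: SpringerLAG1998, 9.6.1] -/
theorem isAlgebraicChar_comp_torusIsoOfCharEquiv_symm {χ : ↥T →* kˣ} (hχ : IsAlgebraicChar χ) :
    IsAlgebraicChar (χ.comp (torusIsoOfCharEquiv hT hT' e).symm.toMonoidHom) := by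
  rw [torusIsoOfCharEquiv_symm]
  exact isAlgebraicChar_comp_torusIsoOfCharEquiv hT' hT e.symm hχ

/-- **`f_T : T → T'` is a morphism of algebraic groups** (polynomial coordinates): `T'` is a torus
whose coordinate ring is spanned by its characters, and `f_T` pulls characters back to characters
(Springer 3.2.3 (b), `IsTorusSubgroup.isAlgebraicGL_of_isAlgebraicChar_comp`).
[cite: SpringerLAG1998, 3.2.3 (b) and 9.6.2 (proof)] -/
theorem isAlgebraicGL_torusIsoOfCharEquiv :
    MonoidHom.IsAlgebraicGL (T'.subtype.comp (torusIsoOfCharEquiv hT hT' e).toMonoidHom) :=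
  hT'.isAlgebraicGL_of_isAlgebraicChar_comp _ fun _ hχ' =>
    isAlgebraicChar_comp_torusIsoOfCharEquiv hT hT' e hχ'

/-- `f_T⁻¹ : T' → T` is a morphism of algebraic groups. [cite: SpringerLAG1998, 3.2.3 (b)] -/
theorem isAlgebraicGL_torusIsoOfCharEquiv_symm :
    MonoidHom.IsAlgebraicGL (T.subtype.comp (torusIsoOfCharEquiv hT hT' e).symm.toMonoidHom) := by
  rw [torusIsoOfCharEquiv_symm]
  exact isAlgebraicGL_torusIsoOfCharEquiv hT' hT e.symm

end Iso

/-! ### The isomorphism of tori of two groups with the same root datum -/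

section Weights

variable {ι X Y : Type*} [AddCommGroup X] [AddCommGroup Y]
variable [IsAlgClosed k] [IsMulCommutative ↥T] [IsMulCommutative ↥T']

/-- **The isomorphism `f_T : T ≃ T'` of two tori whose character groups are identified with the
same lattice `X`** (`eX : X*(T) ≃ X`, `eX' : X*(T') ≃ X`): the isomorphism attached to
`eX⁻¹ ∘ eX' : X*(T') ≃ X*(T)`, so that `χ'_x ∘ f_T = χ_x` for every weight `x`
(`charOfWeight_torusIsoOfWeights`). In the notation of Springer 9.6.1–9.6.2 this is the
isomorphism of tori with `f(f_T) = eX⁻¹ ∘ eX'`. [cite: SpringerLAG1998, 9.6.1–9.6.2] -/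
def torusIsoOfWeights (eX : Additive ↥(characterLattice T) ≃+ X)
    (eX' : Additive ↥(characterLattice T') ≃+ X) (hT : IsTorusSubgroup T)
    (hT' : IsTorusSubgroup T') : ↥T ≃* ↥T' :=
  torusIsoOfCharEquiv hT hT' (eX'.trans eX.symm)

variable (eX : Additive ↥(characterLattice T) ≃+ X) (eX' : Additive ↥(characterLattice T') ≃+ X)
  (hT : IsTorusSubgroup T) (hT' : IsTorusSubgroup T')

/-- **`χ'_x (f_T t) = χ_x (t)`**: `f_T` induces the identity of `X` on characters.
[cite: SpringerLAG1998, 9.6.1–9.6.2] -/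
theorem charOfWeight_torusIsoOfWeights (x : X) (t : ↥T) :
    charOfWeight eX' x (torusIsoOfWeights eX eX' hT hT' t) = charOfWeight eX x t := by
  have h := apply_torusIsoOfCharEquiv hT hT' (eX'.trans eX.symm) t (Additive.toMul (eX'.symm x))
  simp only [ofMul_toMul, AddEquiv.trans_apply, AddEquiv.apply_symm_apply] at h
  exact h

/-- `χ_x (f_T⁻¹ t') = χ'_x (t')`. [cite: SpringerLAG1998, 9.6.1–9.6.2] -/
theorem charOfWeight_torusIsoOfWeights_symm (x : X) (t' : ↥T') :
    charOfWeight eX x ((torusIsoOfWeights eX eX' hT hT').symm t') = charOfWeight eX' x t' := by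
  conv_rhs => rw [← MulEquiv.apply_symm_apply (torusIsoOfWeights eX eX' hT hT') t']
  rw [charOfWeight_torusIsoOfWeights]

/-- The inverse of `torusIsoOfWeights eX eX'` is `torusIsoOfWeights eX' eX`. [folklore] -/
theorem torusIsoOfWeights_symm :
    (torusIsoOfWeights eX eX' hT hT').symm = torusIsoOfWeights eX' eX hT' hT := by
  unfold torusIsoOfWeights
  rw [torusIsoOfCharEquiv_symm]
  rfl

/-- `f_T` is a morphism of algebraic groups. [cite: SpringerLAG1998, 9.6.2 (proof), 3.2.3 (b)] -/
theorem isAlgebraicGL_torusIsoOfWeights :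
    MonoidHom.IsAlgebraicGL (T'.subtype.comp (torusIsoOfWeights eX eX' hT hT').toMonoidHom) :=
  isAlgebraicGL_torusIsoOfCharEquiv hT hT' _

/-- `f_T⁻¹` is a morphism of algebraic groups. [cite: SpringerLAG1998, 9.6.2 (proof), 3.2.3 (b)] -/
theorem isAlgebraicGL_torusIsoOfWeights_symm :
    MonoidHom.IsAlgebraicGL (T.subtype.comp (torusIsoOfWeights eX eX' hT hT').symm.toMonoidHom) :=
  isAlgebraicGL_torusIsoOfCharEquiv_symm hT hT' _

/-- An algebraic character of `T'` pulls back along `f_T` to an algebraic character of `T`.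
[cite: SpringerLAG1998, 9.6.1] -/
theorem isAlgebraicChar_comp_torusIsoOfWeights {χ' : ↥T' →* kˣ} (hχ' : IsAlgebraicChar χ') :
    IsAlgebraicChar (χ'.comp (torusIsoOfWeights eX eX' hT hT').toMonoidHom) :=
  isAlgebraicChar_comp_torusIsoOfCharEquiv hT hT' _ hχ'

omit [IsAlgClosed k] [IsMulCommutative ↥T'] in
/-- Every algebraic character of `T'` is `χ'_x` for the weight `x = eX' χ'`. [folklore] -/
lemma charOfWeight_apply_ofMul (χ' : ↥(characterLattice T')) :
    charOfWeight eX' (eX' (Additive.ofMul χ')) = (χ' : ↥T' →* kˣ) := by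
  simp [charOfWeight]

/-- **Two points of `T'` with the same values of all `χ'_x` are equal** (the characters `χ'_x`,
`x ∈ X`, are all the algebraic characters of `T'`, and these separate points, Springer 3.2.3).
[folklore] -/
theorem eq_of_forall_charOfWeight_eq (hT' : IsTorusSubgroup T') {s t : ↥T'}
    (h : ∀ x : X, charOfWeight eX' x s = charOfWeight eX' x t) : s = t := by
  refine eq_of_forall_char_apply_eq hT'.2.2 fun χ' => ?_
  have e := h (eX' (Additive.ofMul χ'))
  rwa [charOfWeight_apply_ofMul] at e

variable {eX eX' hT hT'}

/-- **`f_T` is determined by `χ'_x ∘ f_T = χ_x`**: any map `g : T → T'` with this property is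
`f_T`. [folklore] -/
theorem eq_torusIsoOfWeights_of_charOfWeight_eq {g : ↥T → ↥T'}
    (hg : ∀ (x : X) (t : ↥T), charOfWeight eX' x (g t) = charOfWeight eX x t) (t : ↥T) :
    g t = torusIsoOfWeights eX eX' hT hT' t :=
  eq_of_forall_charOfWeight_eq eX' hT' fun x => by
    rw [hg, charOfWeight_torusIsoOfWeights]

variable {G : Subgroup (GL n k)} {G' : Subgroup (GL n' k)}
variable {P : RootPairing ι ℤ X Y}
  {eY : Additive ↥(cocharacterLattice T) ≃+ Y} {eY' : Additive ↥(cocharacterLattice T') ≃+ Y}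

/-- **`f_T` matches the cocharacters of the root datum: `f_T (λ_y (s)) = λ'_y (s)`** when `P` is
the root datum of both `(G, T)` (via `eX, eY`) and `(G', T')` (via `eX', eY'`): both sides have
the same values `s^{⟨x, y⟩}` under every `χ'_x` (`IsRootDatumOf.charOfWeight_cocharOfCoweight`,
Springer 3.2.11 (i)), and the `χ'_x` separate points. In particular `f_T ∘ α^∨ = α'^∨` for every
coroot. [cite: SpringerLAG1998, 9.6.1 with 3.2.11 (i)] -/
theorem torusIsoOfWeights_cocharOfCoweight (h : IsRootDatumOf G T P eX eY)
    (h' : IsRootDatumOf G' T' P eX' eY') (y : Y) (s : kˣ) :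
    torusIsoOfWeights eX eX' hT hT' (cocharOfCoweight eY y s) = cocharOfCoweight eY' y s := by
  refine eq_of_forall_charOfWeight_eq eX' hT' fun x => ?_
  rw [charOfWeight_torusIsoOfWeights, h.charOfWeight_cocharOfCoweight,
    h'.charOfWeight_cocharOfCoweight]

/-- The same for the coroots `α_i^∨`, in the ambient groups: `f_T (α_i^∨(s)) = α_i'^∨(s)`.
[cite: SpringerLAG1998, 9.6.1] -/
theorem coe_torusIsoOfWeights_coroot (h : IsRootDatumOf G T P eX eY)
    (h' : IsRootDatumOf G' T' P eX' eY') (i : ι) (s : kˣ) :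
    ((torusIsoOfWeights eX eX' hT hT' (cocharOfCoweight eY (P.coroot i) s) : ↥T') : GL n' k) =
      (cocharOfCoweight eY' (P.coroot i) s : ↥T') := by
  rw [torusIsoOfWeights_cocharOfCoweight h h']

/-! ### Membership form, as consumed by `InducesRootDatumId` -/

/-- For `g ∈ T` (as an element of the ambient `GL n k`), the image point `f_T g ∈ T'` in the
ambient `GL n' k`. Auxiliary packaging for maps defined on larger groups. [folklore] -/
lemma coe_torusIsoOfWeights_mem (t : ↥T) :
    ((torusIsoOfWeights eX eX' hT hT' t : ↥T') : GL n' k) ∈ T' :=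
  (torusIsoOfWeights eX eX' hT hT' t).2

/-- **Transfer of the character identity to maps extending `f_T`.** If a map `F : G → G'`
(of the ambient points) agrees with `f_T` on `T`, then `χ'_x (F t) = χ_x (t)` for `t ∈ T`, in
the membership form of `InducesRootDatumId.charOfWeight_eq`. [folklore] -/
theorem charOfWeight_eq_of_extends {F : GL n k → GL n' k}
    (hF : ∀ t : ↥T, F (t : GL n k) = ((torusIsoOfWeights eX eX' hT hT' t : ↥T') : GL n' k))
    (x : X) (t : GL n k) (ht : t ∈ T) (ht' : F t ∈ T') :
    charOfWeight eX' x ⟨F t, ht'⟩ = charOfWeight eX x ⟨t, ht⟩ := by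
  have e : (⟨F t, ht'⟩ : ↥T') = torusIsoOfWeights eX eX' hT hT' ⟨t, ht⟩ :=
    Subtype.ext (hF ⟨t, ht⟩)
  rw [e, charOfWeight_torusIsoOfWeights]

end Weights

end Literature.NumberTheory.Automorphic

end
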